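import Mathlib
import HarnessLib
import Literature.GroupTheory.PermutationGroups.SylowWitt
import Literature.GroupTheory.PermutationGroups.CycleCommutator

/-!
# Jordan's theorem: a primitive group containing a `p`-cycle with `n ≥ p + 3` contains `Aₙ`

Topic `Literature/GroupTheory/PermutationGroups`.  Fully PROVED (this is the `proof_wanted`
`Equiv.Perm.alternatingGroup_le_of_isPreprimitive_of_isCycle_mem` of Mathlib's
`GroupTheory/GroupAction/Jordan.lean`; Jordan 1873, Wielandt *Finite permutation groups* Thm 13.9).

Proof (elementary; our own arrangement of the classical ingredients).  `p = 2, 3`: Mathlib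
(`subgroup_eq_top_of_isPreprimitive_of_isSwap_mem`, `alternatingGroup_le_of_isPreprimitive_of_isThreeCycle_mem`).
`p ≥ 5`: let `Γ = supp g` (`|Γ| = p`) and `S = Ω ∖ Γ` (`|S| = k ≥ 3`).  `⟨g⟩ ≤ G_(S)` is transitive of
prime degree, hence primitive, on `Γ`, so by Jordan–Marggraf (Mathlib
`IsPreprimitive.isMultiplyPreprimitive`) `G` is `(k+1)`-primitive, hence `k`-transitive.
`P = ⟨g⟩` has the order `p` of a Sylow `p`-subgroup of the pointwise stabilizer `G_(S)` (which
embeds in `Sym(Γ)`, of order `p!`).  By Witt's lemma (`SylowWitt.lean`) `N_G(P)` induces the full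
symmetric group on `S`; pick `a, b ∈ N_G(P)` inducing the transpositions `(δ₁ δ₂)`, `(δ₁ δ₃)` on `S`.
Elements of `N_G(⟨g⟩)` conjugate `g` to powers of `g`, so the commutator `c = [a, b]` commutes with
`g` (`commute_commutator_of_mem_normalizer_zpowers`: the exponents multiply commutatively); an
element commuting with the cycle `g` acts on `Γ` as a power `g^j` (`exists_zpow_eq_on_support_of_commute`).
Hence `g^{-j} c ∈ G` is trivial on `Γ` and equals `[(δ₁ δ₂), (δ₁ δ₃)]` on `S`: it is a 3-cycle, and
Jordan's 3-cycle theorem concludes.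
-/

namespace Literature.GroupTheory.PermutationGroups

open Equiv Equiv.Perm MulAction Subgroup

section jordan

variable {α : Type*} [Fintype α] [DecidableEq α] {G : Subgroup (Perm α)}

/-- The pointwise stabilizer of the complement of the support of a cycle `g ∈ G` acts transitively
on the support. [folklore] -/
theorem isPretransitive_fixingSubgroup_compl_support {g : Perm α} (hg : g.IsCycle) (hgG : g ∈ G) :
    IsPretransitive (fixingSubgroup G ((↑(g.supportᶜ) : Set α)))
      (SubMulAction.ofFixingSubgroup G ((↑(g.supportᶜ) : Set α))) := by
  refine ⟨fun x y => ?_⟩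
  have hx : (x : α) ∈ g.support := by
    have := x.2
    rw [SubMulAction.mem_ofFixingSubgroup_iff] at this
    simpa using this
  have hy : (y : α) ∈ g.support := by
    have := y.2
    rw [SubMulAction.mem_ofFixingSubgroup_iff] at this
    simpa using this
  obtain ⟨i, hi⟩ := hg.exists_zpow_eq (mem_support.mp hx) (mem_support.mp hy)
  have hmem : (⟨g ^ i, G.zpow_mem hgG i⟩ : G) ∈ fixingSubgroup G ((↑(g.supportᶜ) : Set α)) := by
    rw [mem_fixingSubgroup_iff]
    intro z hz
    have hz' : z ∉ g.support := by simpa using hz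
    change (g ^ i) z = z
    exact zpow_apply_eq_self_of_apply_eq_self (notMem_support.mp hz') i
  refine ⟨⟨_, hmem⟩, ?_⟩
  apply Subtype.ext
  change (g ^ i) (x : α) = y
  exact hi

/-- A primitive permutation group containing a cycle `g` of prime length `p` with at least `3`
(indeed `≥ 1` suffices here) further points is `(n - p + 1)`-primitive (Jordan–Marggraf, via
Mathlib's `IsPreprimitive.isMultiplyPreprimitive`). [folklore] -/
theorem isMultiplyPreprimitive_of_isCycle_mem (hG : IsPreprimitive G α) {p : ℕ} (hp : p.Prime)
    {g : Perm α} (hgc : g.IsCycle) (hgp : g.support.card = p) (hg : g ∈ G) {k : ℕ}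
    (hk : g.supportᶜ.card = k) (hk1 : 1 ≤ k) :
    IsMultiplyPreprimitive G α (k + 1) := by
  obtain ⟨m, rfl⟩ : ∃ m, k = m + 1 := ⟨k - 1, by omega⟩
  have hcard : Fintype.card α = p + (m + 1) := by
    have := Finset.card_compl g.support
    omega
  haveI := isPretransitive_fixingSubgroup_compl_support hgc hg
  refine hG.isMultiplyPreprimitive (s := ((↑(g.supportᶜ) : Set α))) (n := m) ?_ ?_ ?_
  · rw [Set.ncard_coe_finset, hk]
  · rw [Nat.card_eq_fintype_card, hcard]
    have := hp.two_le
    omega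
  · apply IsPreprimitive.of_prime_card
    have : Nat.card (SubMulAction.ofFixingSubgroup G ((↑(g.supportᶜ) : Set α))) = p := by
      rw [← hgp, ← Nat.card_eq_finsetCard]
      apply Nat.card_congr
      refine Equiv.subtypeEquivRight fun x => ?_
      rw [SubMulAction.mem_ofFixingSubgroup_iff]
      simp
    rwa [this]

/-- The pointwise stabilizer of the points outside the support of `g ∈ G` embeds in the symmetric
group of the support; hence its order divides `|supp g|!`. [folklore] -/
theorem card_dvd_factorial_of_fixing_compl_support {g : Perm α} (K : Subgroup G)
    (hK : ∀ h ∈ K, ∀ z, z ∉ g.support → (h : Perm α) z = z) :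
    Nat.card K ∣ (g.support.card).factorial := by
  classical
  -- restriction to the support
  have hpres : ∀ h ∈ K, ∀ z, (h : Perm α) z ∈ g.support ↔ z ∈ g.support := by
    intro h hh z
    constructor
    · intro hz
      by_contra hz'
      rw [hK h hh z hz'] at hz
      exact hz' hz
    · intro hz
      by_contra hz'
      -- `h (h z) = h z` forces `h z = z`, so `h z = z ∈ supp g`: contradiction
      have h1 := hK h hh _ hz'
      have h2 : (h : Perm α) z = z := (h : Perm α).injective h1
      apply hz'
      rw [h2]; exact hz
  let φ : K → Perm g.support := fun h =>
    (h.1 : Perm α).subtypePerm (fun z => hpres h.1 h.2 z)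
  have hφ : Function.Injective φ := by
    intro h₁ h₂ he
    apply Subtype.ext; apply Subtype.ext
    ext z
    by_cases hz : z ∈ g.support
    · have := congrArg (fun e : Perm g.support => ((e ⟨z, hz⟩ : g.support) : α)) he
      simpa [φ] using this
    · change ((h₁ : G) : Perm α) z = ((h₂ : G) : Perm α) z
      rw [hK _ h₁.2 z hz, hK _ h₂.2 z hz]
  have := Nat.card_le_card_of_injective φ hφ
  have hdvd : Nat.card K ∣ Nat.card (Perm g.support) := by
    -- `φ` is a group homomorphism; use the subgroup it defines
    let Φ : K →* Perm g.support :=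
      { toFun := φ
        map_one' := by ext z; simp [φ]
        map_mul' := fun h₁ h₂ => by ext z; simp [φ] }
    exact Subgroup.card_dvd_of_injective Φ hφ
  rwa [Nat.card_perm, Nat.card_eq_finsetCard] at hdvd

/-- **Jordan's theorem (1873)** [Wielandt, *Finite permutation groups*, Thm 13.9]: a primitive
permutation group of degree `n` containing a cycle of prime length `p` with `p + 3 ≤ n` contains
the alternating group.  This is Mathlib's `proof_wanted`
`Equiv.Perm.alternatingGroup_le_of_isPreprimitive_of_isCycle_mem`. [folklore] -/
theorem alternatingGroup_le_of_isPreprimitive_of_isCycle_mem (hG : IsPreprimitive G α)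
    {p : ℕ} (hp : p.Prime) (hp' : p + 3 ≤ Nat.card α) {g : Perm α} (hgc : g.IsCycle)
    (hgp : g.support.card = p) (hg : g ∈ G) : alternatingGroup α ≤ G := by
  classical
  -- `p = 2`: a transposition; `p = 3`: a 3-cycle
  rcases hp.eq_two_or_odd' with rfl | hodd
  · have hswap : g.IsSwap := card_support_eq_two.mp hgp
    rw [subgroup_eq_top_of_isPreprimitive_of_isSwap_mem hG g hswap hg]
    exact le_top
  by_cases hp3 : p = 3
  · subst hp3
    exact alternatingGroup_le_of_isPreprimitive_of_isThreeCycle_mem hG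
      (_root_.card_support_eq_three_iff.mp hgp) hg
  have hp5 : 5 ≤ p := by
    have h2 := hp.two_le
    rcases hodd with ⟨m, hm⟩
    omega
  -- notation: `S = Ω ∖ supp g`, `k = |S| ≥ 3`
  set S : Finset α := g.supportᶜ with hS
  set k := S.card with hk
  have hn : Nat.card α = p + k := by
    rw [Nat.card_eq_fintype_card, hk, hS, Finset.card_compl, hgp]
    have : g.support.card ≤ Fintype.card α := Finset.card_le_univ _
    omega
  have hk3 : 3 ≤ k := by omega
  have hmemS : ∀ z, z ∈ S ↔ z ∉ g.support := fun z => by simp [hS]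
  -- `G` is `(k+1)`-primitive, hence `k`-transitive
  haveI hprim : IsMultiplyPreprimitive G α (k + 1) :=
    isMultiplyPreprimitive_of_isCycle_mem hG hp hgc hgp hg hk.symm (by omega)
  haveI : IsMultiplyPretransitive G α (k + 1) := inferInstance
  haveI hktrans : IsMultiplyPretransitive G α k :=
    isMultiplyPretransitive_of_le (n := k + 1) (Nat.le_succ k) (by rw [hn]; omega)
  -- the `k`-tuple `x` enumerating `S`
  let x : Fin k ↪ α := S.equivFin.symm.toEmbedding.trans (Function.Embedding.subtype _)
  have hxS : ∀ i, x i ∈ S := fun i => (S.equivFin.symm i).2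
  have hxsurj : ∀ z ∈ S, ∃ i, x i = z := fun z hz => ⟨S.equivFin ⟨z, hz⟩, by simp [x]⟩
  -- `P = ⟨g⟩ ≤ G`, of order `p`
  set g' : G := ⟨g, hg⟩ with hg'
  set P : Subgroup G := zpowers g' with hP
  have hPfix : ∀ z ∈ S, P ≤ stabilizer G z := by
    intro z hz h hh
    obtain ⟨i, rfl⟩ := mem_zpowers_iff.mp hh
    rw [mem_stabilizer_iff]
    change ((g' ^ i : G) : Perm α) z = z
    rw [Subgroup.coe_zpow]
    exact zpow_apply_eq_self_of_apply_eq_self (notMem_support.mp ((hmemS z).mp hz)) i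
  have hcardP : Nat.card P = p := by
    rw [hP, Nat.card_zpowers, hg', Subgroup.orderOf_mk, hgc.orderOf, hgp]
  haveI : Fact p.Prime := ⟨hp⟩
  -- Sylow condition: `v_p |G_(S)| = 1`
  have hcard : Nat.card P = p ^ (Nat.card (stabilizer G x)).factorization p := by
    have hK : ∀ h ∈ stabilizer G x, ∀ z, z ∉ g.support → (h : Perm α) z = z := by
      intro h hh z hz
      obtain ⟨i, rfl⟩ := hxsurj z ((hmemS z).mpr hz)
      rw [mem_stabilizer_iff] at hh
      have := congrArg (fun e : Fin k ↪ α => e i) hh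
      simpa [Subgroup.smul_def, Equiv.Perm.smul_def] using this
    have hdvd := card_dvd_factorial_of_fixing_compl_support (stabilizer G x) hK
    rw [hgp] at hdvd
    have hle : (Nat.card (stabilizer G x)).factorization p ≤ 1 := by
      have h1 := (Nat.factorization_le_iff_dvd Nat.card_pos.ne' (Nat.factorial_ne_zero _)).mpr
        hdvd p
      have : (p.factorial).factorization p ≤ 1 := by
        have h2 := Nat.factorization_factorial_le_div_pred hp p
        have h3 : p / (p - 1) ≤ 1 := by
          have : p / (p - 1) < 2 := (Nat.div_lt_iff_lt_mul (by omega)).mpr (by omega)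
          omega
        exact h2.trans h3
      exact h1.trans this
    have hge : 1 ≤ (Nat.card (stabilizer G x)).factorization p := by
      have hPle : P ≤ stabilizer G x :=
        (Witt.le_stabilizer_embedding_iff x P).mpr fun i => hPfix _ (hxS i)
      have hpd : p ∣ Nat.card (stabilizer G x) := by
        rw [← hcardP]; exact Subgroup.card_dvd_of_le hPle
      exact (hp.dvd_iff_one_le_factorization Nat.card_pos.ne').mp hpd
    have : (Nat.card (stabilizer G x)).factorization p = 1 := le_antisymm hle hge
    rw [this, pow_one, hcardP]
  -- three distinct points of `S`
  obtain ⟨d₁, hd₁, d₂, hd₂, d₃, hd₃, h₁₂, h₁₃, h₂₃⟩ :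
      ∃ d₁ ∈ S, ∃ d₂ ∈ S, ∃ d₃ ∈ S, d₁ ≠ d₂ ∧ d₁ ≠ d₃ ∧ d₂ ≠ d₃ := by
    rw [hk] at hk3
    obtain ⟨T, hTS, hT3⟩ := Finset.exists_subset_card_eq hk3
    obtain ⟨d₁, d₂, d₃, h₁₂, h₁₃, h₂₃, rfl⟩ := Finset.card_eq_three.mp hT3
    exact ⟨d₁, hTS (by simp), d₂, hTS (by simp), d₃, hTS (by simp), h₁₂, h₁₃, h₂₃⟩
  -- Witt: elements of `N_G(P)` inducing `(d₁ d₂)` and `(d₁ d₃)` on `S`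
  have hWitt : ∀ σ : Perm α, (∀ z ∈ S, σ z ∈ S) →
      ∃ a ∈ normalizer (P : Set G), ∀ z ∈ S, (a : Perm α) z = σ z := by
    intro σ hσ
    let y : Fin k ↪ α := x.trans σ.toEmbedding
    obtain ⟨a, ha, hax⟩ := Witt.exists_mem_normalizer_smul_embedding_eq x y P
      (fun i => hPfix _ (hxS i)) hcard (fun i => hPfix _ (hσ _ (hxS i)))
    refine ⟨a, ha, fun z hz => ?_⟩
    obtain ⟨i, rfl⟩ := hxsurj z hz
    have := congrArg (fun e : Fin k ↪ α => e i) hax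
    simpa [y, Subgroup.smul_def, Equiv.Perm.smul_def] using this
  have hswapS : ∀ {u v : α}, u ∈ S → v ∈ S → ∀ z ∈ S, swap u v z ∈ S := by
    intro u v hu hv z hz
    rcases eq_or_ne z u with rfl | hzu
    · rwa [swap_apply_left]
    rcases eq_or_ne z v with rfl | hzv
    · rwa [swap_apply_right]
    rwa [swap_apply_of_ne_of_ne hzu hzv]
  obtain ⟨a, ha, haS⟩ := hWitt (swap d₁ d₂) (hswapS hd₁ hd₂)
  obtain ⟨b, hb, hbS⟩ := hWitt (swap d₁ d₃) (hswapS hd₁ hd₃)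
  -- the commutator `c = [a, b]` commutes with `g`
  set c : G := a * b * a⁻¹ * b⁻¹ with hc
  have hcomm' : Commute c g' := commute_commutator_of_mem_normalizer_zpowers ha hb
  have hcomm : Commute (c : Perm α) g := by
    show (c : Perm α) * g = g * c
    exact congrArg Subtype.val hcomm'.eq
  -- on `S`, `c` agrees with `(d₁ d₂)(d₁ d₃)(d₁ d₂)(d₁ d₃)`
  have hainv : ∀ z ∈ S, ((a⁻¹ : G) : Perm α) z = swap d₁ d₂ z := by
    intro z hz
    have h1 : ((a : G) : Perm α) (swap d₁ d₂ z) = z := by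
      rw [haS _ (hswapS hd₁ hd₂ z hz), swap_apply_self]
    rw [Subgroup.coe_inv, Perm.inv_eq_iff_eq]
    exact h1.symm
  have hbinv : ∀ z ∈ S, ((b⁻¹ : G) : Perm α) z = swap d₁ d₃ z := by
    intro z hz
    have h1 : ((b : G) : Perm α) (swap d₁ d₃ z) = z := by
      rw [hbS _ (hswapS hd₁ hd₃ z hz), swap_apply_self]
    rw [Subgroup.coe_inv, Perm.inv_eq_iff_eq]
    exact h1.symm
  have hagree : ∀ z, z ∉ g.support →
      (c : Perm α) z = (swap d₁ d₂ * swap d₁ d₃ * swap d₁ d₂ * swap d₁ d₃) z := by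
    intro z hz
    have hz : z ∈ S := (hmemS z).mpr hz
    have e1 := hbinv z hz
    have m1 : swap d₁ d₃ z ∈ S := hswapS hd₁ hd₃ z hz
    have e2 := hainv _ m1
    have m2 : swap d₁ d₂ (swap d₁ d₃ z) ∈ S := hswapS hd₁ hd₂ _ m1
    have e3 := hbS _ m2
    have m3 : swap d₁ d₃ (swap d₁ d₂ (swap d₁ d₃ z)) ∈ S := hswapS hd₁ hd₃ _ m2
    have e4 := haS _ m3
    simp only [hc, Subgroup.coe_mul, Perm.mul_apply]
    rw [e1, e2, e3, e4]
  have hd₁' : d₁ ∉ g.support := (hmemS _).mp hd₁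
  have hd₂' : d₂ ∉ g.support := (hmemS _).mp hd₂
  have hd₃' : d₃ ∉ g.support := (hmemS _).mp hd₃
  have hmem := swap_commutator_mem_of_commute hgc hg c.2 hcomm hd₁' hd₂' hd₃' hagree
  exact alternatingGroup_le_of_isPreprimitive_of_isThreeCycle_mem hG
    (isThreeCycle_swap_commutator h₁₂ h₁₃ h₂₃) hmem

end jordan

end Literature.GroupTheory.PermutationGroups
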